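import Mathlib
import Summits.Ventures.PercRepro2.A3Fibre
import Summits.Ventures.PercRepro2.Exploration
import Summits.Ventures.PercRepro2.Independence
import Summits.Ventures.PercRepro2.BHKEvents
import Summits.Ventures.PercRepro2.BHKAvoid
import Summits.Ventures.PercRepro2.A3FibreLeft

/-!
# The A-fibres of the a₃-exploration: the fibre slack is a BHK 1.4 slack on `G − W`
(blind cell PercRepro2, p5 g12; `proofs/P5-A3FIBRE.md` §2, S4 §2.4 (n))

On a fibre `Q ∩ {C(a₃) = W}` with neither root in `W` (world A = PD) every connection event of
the roots is the corresponding event of the graph `G − W` (the edges touching `W` closed: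
`delConfig`), and the slack of `A3Fibre.slack` is
`2·[P(f, b ∈ C₁)·P(f, o ∈ C₂) − P(f)·P(f, b ∈ C₁, o ∈ C₂)] + (the mirror pair) ≥ 0` — each bracket
is BHK06 Thm 1.4 (`bhk_cross_cluster_avoid`) on `G − W`, reached through the **pinned-weights
identity** `prob (zeroOn p T) A = prob p {ω | closeOn ω T ∈ A}` (`prob_zeroOn`, by induction on `T`
from `expect_update_zero`) with `T` the edges touching `W`, and the spatial Markov factorisation
`prob_clusterEvent_inter_eq_mul`.  Main theorem: **`slack_nonneg_of_notMem`**.  Together with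
`A3FibreLeft.slack_nonneg_of_mem_left / _right` every fibre slack is nonnegative
(`slack_nonneg`); the assembly `Gc = P(PD)·P(Q)·(∑ W, slack W / mW W + btw)` remains.
-/

namespace Summit.Ventures.PercRepro2

open UnionCluster

namespace CovForm

namespace A3Fibre

/-! ## Pinned weights = forced-closed configurations -/

section Pin

variable {E : Type*} [Fintype E] [DecidableEq E] {R : Type*} [CommRing R]

/-- The weights with every edge of `T` set to `0`. -/
def zeroOn (p : E → R) (T : Finset E) : E → R := fun e => if e ∈ T then 0 else p e

/-- The configuration with every edge of `T` closed. -/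
def closeOn (ω : Config E) (T : Finset E) : Config E := fun e => if e ∈ T then false else ω e

omit [Fintype E] in
/-- `zeroOn` on the empty set. -/
lemma zeroOn_empty (p : E → R) : zeroOn p ∅ = p := by
  funext e; simp [zeroOn]

omit [Fintype E] in
/-- `closeOn` on the empty set. -/
lemma closeOn_empty (ω : Config E) : closeOn ω ∅ = ω := by
  funext e; simp [closeOn]

omit [Fintype E] in
/-- `zeroOn` on an inserted edge. -/
lemma zeroOn_insert (p : E → R) (e : E) (T : Finset E) :
    zeroOn p (insert e T) = Function.update (zeroOn p T) e 0 := by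
  funext e'
  by_cases h : e' = e
  · subst h; simp [zeroOn]
  · simp [zeroOn, h]

omit [Fintype E] in
/-- `closeOn` on an inserted edge. -/
lemma closeOn_insert (ω : Config E) (e : E) (T : Finset E) :
    closeOn ω (insert e T) = Function.update (closeOn ω T) e false := by
  funext e'
  by_cases h : e' = e
  · subst h; simp [closeOn]
  · simp [closeOn, h]

/-- **Forcing identity for a set of edges**: the expectation with the edges of `T` pinned closed
is the expectation of the observable evaluated with those edges forced closed. -/
theorem expect_zeroOn (p : E → R) (T : Finset E) (f : Config E → R) :
    expect (zeroOn p T) f = expect p (fun ω => f (closeOn ω T)) := by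
  induction T using Finset.induction_on generalizing f with
  | empty => simp [zeroOn_empty, closeOn_empty]
  | insert e T _ ih =>
    rw [zeroOn_insert, expect_update_zero, ih]
    exact congrArg (expect p) (funext fun ω => by rw [closeOn_insert])

/-- **Pinned-weights identity for events**: `P_{p[T ↦ 0]}(A) = P_p(closeOn · T ∈ A)`. -/
theorem prob_zeroOn (p : E → R) (T : Finset E) (A : Set (Config E)) :
    prob (zeroOn p T) A = prob p {ω | closeOn ω T ∈ A} := by
  simp only [prob_eq_expect_indicator]
  rw [expect_zeroOn]
  refine congrArg (expect p) (funext fun ω => ?_)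
  by_cases h : closeOn ω T ∈ A
  · rw [Set.indicator_of_mem h, Set.indicator_of_mem (show ω ∈ {ω | closeOn ω T ∈ A} from h)]
    rfl
  · rw [Set.indicator_of_notMem h, Set.indicator_of_notMem (show ω ∉ {ω | closeOn ω T ∈ A} from h)]

variable [PartialOrder R] [IsOrderedRing R]

omit [Fintype E] in
/-- Pinning edges to `0` keeps the weights admissible. -/
lemma isProbVec_zeroOn {p : E → R} (hp : IsProbVec p) (T : Finset E) : IsProbVec (zeroOn p T) := by
  refine ⟨fun e => ?_, fun e => ?_⟩ <;> simp only [zeroOn] <;> split_ifs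
  · exact le_rfl
  · exact hp.nonneg e
  · exact zero_le_one
  · exact hp.le_one e

end Pin

/-! ## The deleted-graph events on an A-fibre -/

section AFibre

variable {V : Type*} {E : Type*} [Fintype V] [DecidableEq V] [Fintype E] [DecidableEq E]

open Classical in
/-- The edges touching `W`, as a `Finset`. -/
noncomputable def touchFinset (ends : E → Sym2 V) (W : Finset V) : Finset E :=
  Finset.univ.filter (· ∈ touches ends (↑W : Set V))

/-- Closing the touching edges is `delConfig`. -/
lemma closeOn_touchFinset (ends : E → Sym2 V) (W : Finset V) (ω : Config E) :
    closeOn ω (touchFinset ends W) = delConfig ends (↑W : Set V) ω := by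
  classical
  funext e
  by_cases h : e ∈ touches ends (↑W : Set V)
  · rw [delConfig_apply_of_mem h]; simp [closeOn, touchFinset, h]
  · rw [delConfig_apply_of_notMem h]; simp [closeOn, touchFinset, h]

/-- The preimage of an event under `delConfig`: the event «`Y` holds in `G − W`». -/
def delEvent (ends : E → Sym2 V) (W : Finset V) (Y : Set (Config E)) : Set (Config E) :=
  {ω | delConfig ends (↑W : Set V) ω ∈ Y}

omit [Fintype V] [DecidableEq V] [Fintype E] [DecidableEq E] in
/-- `delEvent` depends only on the edges not touching `W`. -/
lemma dependsOn_delEvent (ends : E → Sym2 V) (W : Finset V) (Y : Set (Config E))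
    [DecidablePred (· ∈ (touches ends (↑W : Set V))ᶜ)] :
    DependsOn (· ∈ delEvent ends W Y) (touches ends (↑W : Set V))ᶜ := by
  have : delEvent ends W Y = {ω | restrict (touches ends (↑W : Set V))ᶜ ω ∈ Y} := by
    ext ω; simp only [delEvent, Set.mem_setOf_eq, delConfig_eq_restrict]
  rw [this]
  exact dependsOn_restrict _ (· ∈ Y)

variable {R : Type*} [CommRing R]

/-- Pinned-weights probabilities are `delEvent` probabilities. -/
lemma prob_zeroOn_touch (p : E → R) (ends : E → Sym2 V) (W : Finset V) (Y : Set (Config E)) :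
    prob (zeroOn p (touchFinset ends W)) Y = prob p (delEvent ends W Y) := by
  rw [prob_zeroOn]
  congr 1
  ext ω
  simp only [Set.mem_setOf_eq, delEvent, closeOn_touchFinset]

/-- Spatial Markov factorisation for a `delEvent`. -/
lemma prob_clusterEvent_inter_delEvent (p : E → R) (ends : E → Sym2 V) (a₃ : V) (W : Finset V)
    (Y : Set (Config E)) :
    prob p (clusterEvent ends a₃ (↑W : Set V) ∩ delEvent ends W Y) =
      prob p (clusterEvent ends a₃ (↑W : Set V)) * prob p (delEvent ends W Y) := by
  classical
  exact prob_clusterEvent_inter_eq_mul p ends a₃ _ (dependsOn_delEvent ends W Y)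
    disjoint_compl_right

omit [Fintype V] [DecidableEq V] [Fintype E] [DecidableEq E] in
/-- On `{C(a₃) = W}`, for `u ∉ W`, `u ↔ w` iff `u ↔ w` in `G − W`. -/
lemma conn_iff_delConfig {ends : E → Sym2 V} {a₃ u w : V} {W : Finset V} (hu : u ∉ W)
    {ω : Config E} (hω : ω ∈ clusterEvent ends a₃ (↑W : Set V)) :
    Conn ends ω u w ↔ Conn ends (delConfig ends (↑W : Set V) ω) u w := by
  classical
  rw [mem_clusterEvent] at hω
  have hu' : u ∉ (↑W : Set V) := fun h => hu (Finset.mem_coe.1 h)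
  rw [delConfig_eq_restrict]
  exact (conn_restrict_iff_of_cluster_eq hω hu').symm

omit [Fintype V] [DecidableEq V] [Fintype E] [DecidableEq E] in
/-- On `{C(a₃) = W}`, a root outside `W` is not joined to a vertex of `W`. -/
lemma not_conn_of_mem_of_notMem {ends : E → Sym2 V} {a₃ u v : V} {W : Finset V} (hu : u ∉ W)
    (hv : v ∈ W) {ω : Config E} (hω : ω ∈ clusterEvent ends a₃ (↑W : Set V)) :
    ¬ Conn ends ω u v := by
  intro h
  rw [mem_clusterEvent] at hω
  have hv' : Conn ends ω a₃ v := by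
    have : v ∈ cluster ends ω a₃ := by rw [hω]; exact Finset.mem_coe.2 hv
    exact this
  have : u ∈ cluster ends ω a₃ := conn_trans hv' (conn_symm h)
  rw [hω] at this
  exact hu (Finset.mem_coe.1 this)

omit [Fintype V] [DecidableEq V] [Fintype E] [DecidableEq E] in
/-- `{a₂ ↮ a₁} = {a₁ ↮ a₂}`. -/
lemma avoidAll_symm (ends : E → Sym2 V) (a₁ a₂ : V) :
    avoidAll ends a₂ {a₁} = avoidAll ends a₁ {a₂} := by
  ext ω
  simp only [mem_avoidAll, Finset.mem_singleton, forall_eq]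
  exact ⟨fun h hc => h (conn_symm hc), fun h hc => h (conn_symm hc)⟩

omit [Fintype V] [DecidableEq V] [Fintype E] [DecidableEq E] in
/-- On an A-fibre (`a₁, a₂ ∉ W`), `Q ∩ {C(a₃) = W} ∩ {a₁ ↔ b} ∩ {a₂ ↔ o}` is the `delEvent` of
BHK's event `{C(a₁) ∋ b} ∩ {C(a₂) ∋ o} ∩ {a₁ ↮ a₂}`, and likewise for its marginals. -/
lemma fibre_eq_delEvent_pair (ends : E → Sym2 V) (a₁ a₂ a₃ b o : V) {W : Finset V}
    (h₁ : a₁ ∉ W) (h₂ : a₂ ∉ W) :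
    fibre ends a₁ a₂ a₃ W ∩ (connEvent ends a₁ b ∩ connEvent ends a₂ o) =
      clusterEvent ends a₃ (↑W : Set V) ∩ delEvent ends W
        (clusterInEvent ends a₁ {S | b ∈ S} ∩ clusterInEvent ends a₂ {S | o ∈ S} ∩
          avoidAll ends a₁ {a₂}) := by
  ext ω
  simp only [fibre, Set.mem_inter_iff, mem_connEvent, delEvent, Set.mem_setOf_eq,
    clusterInEvent, mem_cluster, mem_avoidAll, Finset.mem_singleton, forall_eq]
  constructor
  · rintro ⟨⟨hQ, hω⟩, hb, ho⟩
    refine ⟨hω, ⟨(conn_iff_delConfig h₁ hω).1 hb, (conn_iff_delConfig h₂ hω).1 ho⟩, ?_⟩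
    intro hc
    exact hQ (conn_symm ((conn_iff_delConfig h₁ hω).2 hc))
  · rintro ⟨hω, ⟨hb, ho⟩, hQ⟩
    refine ⟨⟨?_, hω⟩, (conn_iff_delConfig h₁ hω).2 hb, (conn_iff_delConfig h₂ hω).2 ho⟩
    intro hc
    exact hQ ((conn_iff_delConfig h₁ hω).1 (conn_symm hc))

omit [Fintype V] [DecidableEq V] [Fintype E] [DecidableEq E] in
/-- The marginal `Q ∩ {C(a₃) = W} ∩ {a₁ ↔ b}` on an A-fibre. -/
lemma fibre_eq_delEvent_left (ends : E → Sym2 V) (a₁ a₂ a₃ b : V) {W : Finset V}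
    (h₁ : a₁ ∉ W) :
    fibre ends a₁ a₂ a₃ W ∩ connEvent ends a₁ b =
      clusterEvent ends a₃ (↑W : Set V) ∩ delEvent ends W
        (clusterInEvent ends a₁ {S | b ∈ S} ∩ avoidAll ends a₁ {a₂}) := by
  ext ω
  simp only [fibre, Set.mem_inter_iff, mem_connEvent, delEvent, Set.mem_setOf_eq,
    clusterInEvent, mem_cluster, mem_avoidAll, Finset.mem_singleton, forall_eq]
  constructor
  · rintro ⟨⟨hQ, hω⟩, hb⟩
    refine ⟨hω, (conn_iff_delConfig h₁ hω).1 hb, ?_⟩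
    intro hc
    exact hQ (conn_symm ((conn_iff_delConfig h₁ hω).2 hc))
  · rintro ⟨hω, hb, hQ⟩
    refine ⟨⟨?_, hω⟩, (conn_iff_delConfig h₁ hω).2 hb⟩
    intro hc
    exact hQ ((conn_iff_delConfig h₁ hω).1 (conn_symm hc))

omit [Fintype V] [DecidableEq V] [Fintype E] [DecidableEq E] in
/-- The marginal `Q ∩ {C(a₃) = W} ∩ {a₂ ↔ o}` on an A-fibre. -/
lemma fibre_eq_delEvent_right (ends : E → Sym2 V) (a₁ a₂ a₃ o : V) {W : Finset V}
    (h₁ : a₁ ∉ W) (h₂ : a₂ ∉ W) :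
    fibre ends a₁ a₂ a₃ W ∩ connEvent ends a₂ o =
      clusterEvent ends a₃ (↑W : Set V) ∩ delEvent ends W
        (clusterInEvent ends a₂ {S | o ∈ S} ∩ avoidAll ends a₁ {a₂}) := by
  ext ω
  simp only [fibre, Set.mem_inter_iff, mem_connEvent, delEvent, Set.mem_setOf_eq,
    clusterInEvent, mem_cluster, mem_avoidAll, Finset.mem_singleton, forall_eq]
  constructor
  · rintro ⟨⟨hQ, hω⟩, ho⟩
    refine ⟨hω, (conn_iff_delConfig h₂ hω).1 ho, ?_⟩
    intro hc
    exact hQ (conn_symm ((conn_iff_delConfig h₁ hω).2 hc))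
  · rintro ⟨hω, ho, hQ⟩
    refine ⟨⟨?_, hω⟩, (conn_iff_delConfig h₂ hω).2 ho⟩
    intro hc
    exact hQ ((conn_iff_delConfig h₁ hω).1 (conn_symm hc))

omit [Fintype V] [DecidableEq V] [Fintype E] [DecidableEq E] in
/-- The fibre itself on an A-fibre. -/
lemma fibre_eq_delEvent (ends : E → Sym2 V) (a₁ a₂ a₃ : V) {W : Finset V} (h₁ : a₁ ∉ W) :
    fibre ends a₁ a₂ a₃ W =
      clusterEvent ends a₃ (↑W : Set V) ∩ delEvent ends W (avoidAll ends a₁ {a₂}) := by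
  ext ω
  simp only [fibre, Set.mem_inter_iff, delEvent, Set.mem_setOf_eq, mem_avoidAll,
    Finset.mem_singleton, forall_eq]
  constructor
  · rintro ⟨hQ, hω⟩
    refine ⟨hω, fun hc => hQ (conn_symm ((conn_iff_delConfig h₁ hω).2 hc))⟩
  · rintro ⟨hω, hQ⟩
    exact ⟨fun hc => hQ ((conn_iff_delConfig h₁ hω).1 (conn_symm hc)), hω⟩

variable [LinearOrder R] [IsStrictOrderedRing R]

/-- **BHK 1.4 on an A-fibre**: `P(f)·P(f, a₁ ↔ b, a₂ ↔ o) ≤ P(f, a₁ ↔ b)·P(f, a₂ ↔ o)`. -/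
theorem fibre_bhk (p : E → R) (hp : IsProbVec p) (ends : E → Sym2 V) (a₁ a₂ a₃ b o : V)
    {W : Finset V} (h₁ : a₁ ∉ W) (h₂ : a₂ ∉ W) :
    prob p (fibre ends a₁ a₂ a₃ W) *
        prob p (fibre ends a₁ a₂ a₃ W ∩ (connEvent ends a₁ b ∩ connEvent ends a₂ o)) ≤
      prob p (fibre ends a₁ a₂ a₃ W ∩ connEvent ends a₁ b) *
        prob p (fibre ends a₁ a₂ a₃ W ∩ connEvent ends a₂ o) := by
  have hU : IsUpperSet {S : Set V | b ∈ S} := fun S S' h hb => h hb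
  have hV : IsUpperSet {S : Set V | o ∈ S} := fun S S' h ho => h ho
  have hbhk := bhk_cross_cluster_avoid (zeroOn p (touchFinset ends W)) (isProbVec_zeroOn hp _) ends a₁ a₂
    (Finset.mem_singleton_self a₂) hU hV
  simp only [prob_zeroOn_touch] at hbhk
  rw [fibre_eq_delEvent_pair ends a₁ a₂ a₃ b o h₁ h₂, fibre_eq_delEvent_left ends a₁ a₂ a₃ b h₁,
    fibre_eq_delEvent_right ends a₁ a₂ a₃ o h₁ h₂, fibre_eq_delEvent ends a₁ a₂ a₃ h₁,
    prob_clusterEvent_inter_delEvent, prob_clusterEvent_inter_delEvent,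
    prob_clusterEvent_inter_delEvent, prob_clusterEvent_inter_delEvent]
  have hcl := prob_nonneg hp (clusterEvent ends a₃ (↑W : Set V))
  have := mul_le_mul_of_nonneg_left hbhk (mul_nonneg hcl hcl)
  nlinarith [this]

omit [Fintype V] [DecidableEq V] [Fintype E] [DecidableEq E] in
/-- The fibre does not depend on the order of the roots. -/
lemma fibre_swap (ends : E → Sym2 V) (a₁ a₂ a₃ : V) (W : Finset V) :
    fibre ends a₂ a₁ a₃ W = fibre ends a₁ a₂ a₃ W := by
  rw [fibre, fibre, avoidAll_symm ends a₁ a₂]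

omit [Fintype V] [DecidableEq V] [Fintype E] [DecidableEq E] in
/-- With both roots in `W` the fibre is empty (`Q` fails). -/
lemma fibre_eq_empty_of_mem_mem (ends : E → Sym2 V) (a₁ a₂ a₃ : V) {W : Finset V} (h₁ : a₁ ∈ W)
    (h₂ : a₂ ∈ W) : fibre ends a₁ a₂ a₃ W = ∅ := by
  ext ω
  simp only [fibre, Set.mem_inter_iff, mem_clusterEvent, mem_avoidAll, Finset.mem_singleton,
    forall_eq, Set.mem_empty_iff_false, iff_false, not_and]
  intro hQ hω
  apply hQ
  have h₁' : Conn ends ω a₃ a₁ := by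
    have : a₁ ∈ cluster ends ω a₃ := by rw [hω]; exact Finset.mem_coe.2 h₁
    exact this
  have h₂' : Conn ends ω a₃ a₂ := by
    have : a₂ ∈ cluster ends ω a₃ := by rw [hω]; exact Finset.mem_coe.2 h₂
    exact this
  exact conn_trans (conn_symm h₂') h₁'

end AFibre

section Main

variable {V : Type*} {E : Type*} [Fintype V] [DecidableEq V] [Fintype E] [DecidableEq E]
  {R : Type*} [Field R] [LinearOrder R] [IsStrictOrderedRing R]

/-- **The A-fibres have nonnegative slack** (BHK 1.4 on `G − W`, twice). -/
theorem slack_nonneg_of_notMem (p : E → R) (hp : IsProbVec p) (ends : E → Sym2 V)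
    (o a₁ a₂ a₃ b : V) {W : Finset V} (h₁ : a₁ ∉ W) (h₂ : a₂ ∉ W) :
    0 ≤ slack p ends o a₁ a₂ a₃ b W := by
  have hs3 : s3 (R := R) a₁ a₂ W = 0 := by simp [s3, h₁, h₂]
  have hA : a₁ ∉ W ∧ a₂ ∉ W := ⟨h₁, h₂⟩
  have h12 := fibre_bhk p hp ends a₁ a₂ a₃ b o h₁ h₂
  have h21 := fibre_bhk p hp ends a₂ a₁ a₃ b o h₂ h₁
  rw [fibre_swap] at h21
  simp only [slack, Ssig, Su, SF, mW, hs3, if_pos hA]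
  nlinarith [h12, h21]

/-- **Every fibre slack is nonnegative**: the A-fibres by BHK 1.4 (`slack_nonneg_of_notMem`),
the T / T′-fibres by Harris (`slack_nonneg_of_mem_left / _right`), and the fibres with both roots
in `W` are empty. -/
theorem slack_nonneg (p : E → R) (hp : IsProbVec p) (ends : E → Sym2 V) (o a₁ a₂ a₃ b : V)
    (W : Finset V) : 0 ≤ slack p ends o a₁ a₂ a₃ b W := by
  by_cases h₁ : a₁ ∈ W
  · by_cases h₂ : a₂ ∈ W
    · have hf := fibre_eq_empty_of_mem_mem ends a₁ a₂ a₃ h₁ h₂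
      simp only [slack, Ssig, Su, SF, mW, hf, Set.empty_inter, prob_empty]
      simp
    · exact slack_nonneg_of_mem_left p hp ends o a₁ a₂ a₃ b h₁ h₂
  · by_cases h₂ : a₂ ∈ W
    · exact slack_nonneg_of_mem_right p hp ends o a₁ a₂ a₃ b h₁ h₂
    · exact slack_nonneg_of_notMem p hp ends o a₁ a₂ a₃ b h₁ h₂

end Main

end A3Fibre

end CovForm

end Summit.Ventures.PercRepro2
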